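import Summits.PneNP.PneNP.Theses.DelsarteLasserre

/-!
# Route DelsarteLasserre — `Assembly` (stmt-PneNP-10733)

`Assembly := CodeSizeLangInNEXP → NexpSubsetExpOfNpSubsetP → ClassBridges → Target → PneNP`: the cruxes-to-summit composition of route DelsarteLasserre, which is exactly the route's
deciding theorem `Summit.PneNP.PneNP.Theses.DelsarteLasserre.closes` (planner-authored, elaborated with the route file) applied to the
same hypotheses. This file imports only the route file (cone hygiene).
-/

set_option linter.dupNamespace false -- `Summit.PneNP.PneNP.…`: summit = sub-problem name (D-0017 single-conjunct layout)

namespace Summit.PneNP.PneNP.Theorems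

/-- **Assembly item of route DelsarteLasserre (stmt-PneNP-10733)**: `CodeSizeLangInNEXP → NexpSubsetExpOfNpSubsetP → ClassBridges → Target → PneNP`, by the route's deciding theorem
`DelsarteLasserre.closes`. [folklore] -/
theorem delsarteLasserre_assembly_proof : Summit.PneNP.PneNP.Theses.DelsarteLasserre.Assembly := by
  unfold Summit.PneNP.PneNP.Theses.DelsarteLasserre.Assembly
  exact fun hF1 hF2 hF3 hT => Summit.PneNP.PneNP.Theses.DelsarteLasserre.closes hT hF1 hF2 hF3

end Summit.PneNP.PneNP.Theorems
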